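import Mathlib
import Summits.Ventures.HodgeRepro.GaussSumStability

/-!
# GaussSumTwistExists — a primitive twist exists: characters of `1 + I` extend to `R^×`

Blind re-derivation cell `pub-hodge-repro`, seat night-2 (gen 1).  Target tree path
`lean/Summits/Ventures/HodgeRepro/GaussSumTwistExists.lean`.  Continues `GaussSumStability.lean`, whose stability
theorem takes a multiplicative character `ρ` with `ρ(1 + z) = ψ(a z)` on a square-zero ideal `I` (`a` a unit) as a
HYPOTHESIS (`Primitive` in `PeriodCloserC7Stability.lean`).  This file shows such a `ρ` EXISTS for every `a`: the
map `1 + z ↦ ψ(a z)` is a character of the subgroup `1 + I ≤ R^×` (because `(1+z)(1+z') = 1 + z + z'` when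
`I · I = 0`), and a character of a subgroup of an abelian group with values in `ℂ^×` extends to the whole group —
`ℂ^×` is divisible (`n`-th roots exist, `IsAlgClosed.exists_pow_nat_eq`), hence an injective `ℤ`-module (Baer's
criterion, Mathlib `Module.Baer.of_divisible` / `extension_property_addMonoidHom`).

So the twist of ROUTE-B §9.9 (d) — «`ρ` a conjugate-orthogonal character of `K_v^×` of conductor `c`» — has, on the
finite-ring model `R = 𝒪/𝔭^c`, a local representative of EXACT conductor `c` for every unit parameter `a`
(`exists_primitive_mulChar`); the conjugate-orthogonality and the global realisation (ROUTE-B §9.12 (c)) are outside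
the model.  Nothing here says anything about the status of the Hodge conjecture for CM abelian varieties, which is
NOT proved.
-/

set_option autoImplicit false

noncomputable section

namespace Summit.Ventures.HodgeRepro.GaussSumStability

/-! ### `ℂ^×` is divisible, hence characters of subgroups extend -/

/-- `ℂ^×` is `ℕ`-rootable: every unit has an `n`-th root for `n ≠ 0`. -/
noncomputable instance instRootableByUnitsComplexNat : RootableBy ℂˣ ℕ :=
  rootableByOfPowLeftSurj ℂˣ ℕ fun {n} hn a => by
    obtain ⟨z, hz⟩ := IsAlgClosed.exists_pow_nat_eq (a : ℂ) (Nat.pos_of_ne_zero hn)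
    have hz0 : z ≠ 0 := by
      intro h
      rw [h, zero_pow hn] at hz
      exact a.ne_zero hz.symm
    exact ⟨Units.mk0 z hz0, Units.ext (by simp [hz])⟩

/-- `ℂ^×` is `ℤ`-rootable. -/
noncomputable instance instRootableByUnitsComplexInt : RootableBy ℂˣ ℤ :=
  Group.rootableByIntOfRootableByNat ℂˣ

/-- `Additive ℂ^×` is `ℤ`-divisible. -/
noncomputable instance instDivisibleByAdditiveUnitsComplex : DivisibleBy (Additive ℂˣ) ℤ where
  div a n := Additive.ofMul (RootableBy.root (Additive.toMul a) n)
  div_zero a := by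
    show Additive.ofMul (RootableBy.root (Additive.toMul a) (0 : ℤ)) = 0
    rw [RootableBy.root_zero]
    rfl
  div_cancel {n} a hn := by
    show n • Additive.ofMul (RootableBy.root (Additive.toMul a) n) = a
    rw [← ofMul_zpow, RootableBy.root_cancel _ hn]
    rfl

/-- **Characters extend**: a homomorphism from a subgroup `H` of a commutative group `G` to `ℂ^×` is the
restriction of a homomorphism `G →* ℂ^×`. -/
theorem exists_monoidHom_extension {G : Type} [CommGroup G] (H : Subgroup G) (φ : H →* ℂˣ) :
    ∃ Φ : G →* ℂˣ, ∀ h : H, Φ h = φ h := by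
  have hB : Module.Baer ℤ (Additive ℂˣ) := Module.Baer.of_divisible (Additive ℂˣ)
  obtain ⟨g, hg⟩ := hB.extension_property_addMonoidHom (MonoidHom.toAdditive H.subtype)
    (fun x y hxy => by
      have := congrArg Additive.toMul hxy
      exact Additive.toMul.injective (Subtype.ext this))
    (MonoidHom.toAdditive φ)
  refine ⟨MonoidHom.toAdditive.symm g, fun h => ?_⟩
  have := DFunLike.congr_fun hg (Additive.ofMul h)
  exact this

/-! ### The subgroup `1 + I` and its character `1 + z ↦ ψ(a z)` -/

variable {R : Type} [CommRing R]

/-- The subgroup `1 + I` of `R^×` (for a square-zero ideal `I`): the units `u` with `u − 1 ∈ I`. -/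
def oneAddSubgroup (I : Ideal R) : Subgroup Rˣ where
  carrier := {u | (u : R) - 1 ∈ I}
  one_mem' := by simp
  mul_mem' {u v} hu hv := by
    have h : ((u * v : Rˣ) : R) - 1 = ((u : R) - 1) * ((v : R) - 1) + ((u : R) - 1) + ((v : R) - 1) := by
      rw [Units.val_mul]; ring
    rw [Set.mem_setOf_eq, h]
    exact I.add_mem (I.add_mem (I.mul_mem_right _ hu) hu) hv
  inv_mem' {u} hu := by
    have h : ((u⁻¹ : Rˣ) : R) - 1 = -((u⁻¹ : Rˣ) : R) * ((u : R) - 1) := by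
      linear_combination Units.inv_mul u
    rw [Set.mem_setOf_eq, h]
    exact I.mul_mem_left _ hu

/-- Membership in `1 + I`. -/
theorem mem_oneAddSubgroup (I : Ideal R) (u : Rˣ) : u ∈ oneAddSubgroup I ↔ (u : R) - 1 ∈ I := Iff.rfl

/-- The value `ψ x` of an additive character is a unit of `ℂ` (inverse `ψ (−x)`). -/
def AddChar.toUnit (ψ : AddChar R ℂ) (x : R) : ℂˣ where
  val := ψ x
  inv := ψ (-x)
  val_inv := by rw [← AddChar.map_add_eq_mul, add_neg_cancel, AddChar.map_zero_eq_one]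
  inv_val := by rw [← AddChar.map_add_eq_mul, neg_add_cancel, AddChar.map_zero_eq_one]

/-- The unit `ψ x` has value `ψ x`. -/
@[simp] theorem AddChar.toUnit_val (ψ : AddChar R ℂ) (x : R) : (AddChar.toUnit ψ x : ℂ) = ψ x := rfl

/-- **The character `1 + z ↦ ψ(a z)` of `1 + I`** (a homomorphism because `I · I = 0`). -/
def oneAddChar (ψ : AddChar R ℂ) (I : Ideal R) (hI : ∀ z ∈ I, ∀ z' ∈ I, z * z' = 0) (a : R) :
    oneAddSubgroup I →* ℂˣ where
  toFun u := AddChar.toUnit ψ (a * ((u : Rˣ) : R) - a)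
  map_one' := by
    apply Units.ext
    simp only [AddChar.toUnit_val, Subgroup.coe_one, Units.val_one, mul_one, sub_self, AddChar.map_zero_eq_one,
      Units.val_one]
  map_mul' u v := by
    apply Units.ext
    simp only [AddChar.toUnit_val, Subgroup.coe_mul, Units.val_mul]
    have hu : ((u : Rˣ) : R) - 1 ∈ I := u.2
    have hv : ((v : Rˣ) : R) - 1 ∈ I := v.2
    have h0 : (((u : Rˣ) : R) - 1) * (((v : Rˣ) : R) - 1) = 0 := hI _ hu _ hv
    have h : a * (((u : Rˣ) : R) * ((v : Rˣ) : R)) - a = (a * ((u : Rˣ) : R) - a) + (a * ((v : Rˣ) : R) - a) := by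
      linear_combination a * h0
    rw [h, AddChar.map_add_eq_mul]

/-- **A primitive twist exists on the model**: for every additive character `ψ`, square-zero ideal `I` and element
`a`, there is a multiplicative character `ρ` of `R` with `ρ(1 + z) = ψ(a z)` for all `z ∈ I` — the hypothesis
`Primitive` of the stability theorem is satisfiable (for `a` a unit: a twist of exact conductor `c`). -/
theorem exists_primitive_mulChar (ψ : AddChar R ℂ) (I : Ideal R) (hI : ∀ z ∈ I, ∀ z' ∈ I, z * z' = 0) (a : R) :
    ∃ ρ : MulChar R ℂ, ∀ z ∈ I, ρ (1 + z) = ψ (a * z) := by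
  obtain ⟨Φ, hΦ⟩ := exists_monoidHom_extension (oneAddSubgroup I) (oneAddChar ψ I hI a)
  refine ⟨MulChar.ofUnitHom Φ, fun z hz => ?_⟩
  have hmem : unitOfSqZero z (hI z hz z hz) ∈ oneAddSubgroup I := by
    rw [mem_oneAddSubgroup, unitOfSqZero_val, add_sub_cancel_left]
    exact hz
  have h1 : (1 + z : R) = (unitOfSqZero z (hI z hz z hz) : R) := rfl
  rw [h1, MulChar.ofUnitHom_coe, hΦ ⟨_, hmem⟩]
  show (AddChar.toUnit ψ (a * (1 + z) - a) : ℂ) = ψ (a * z)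
  rw [AddChar.toUnit_val, mul_add, mul_one, add_sub_cancel_left]

end Summit.Ventures.HodgeRepro.GaussSumStability

end
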